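import Mathlib
import Literature.MathematicalPhysics.QuantumLattice.HubbardBandSectorCountingToolbox
import HarnessLib

/-!
# Four-sector counting, fold ranges: the ONE-SIDED anti-diagonal count (the elliptic umklapp-corner window carries no `t`-cells beyond the cluster)

Topic `Literature/MathematicalPhysics/QuantumLattice`; sub-namespace `BandSectorCounting` (continues `HubbardBandSectorCountingToolbox`).
Third file of the log-free ANISOTROPIC anchored four-sector counting lemma («E1-P2-THIN-COUNT», cell gate-hubbard-kl, plan g17 (R41); seat p4; plan
HOME/prover-p4/E1-P2-THIN-COUNT-PLAN.md §Refinement 2).  The fold-range fibre count `gridCount_L5` (F(t) = h(σ−t/2, σ+t/2) along the anti-diagonal,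
`|F′(t)| ≥ c·t`) is SIGN-BLIND: it bounds `#{t-cells : |F(t)| ≤ δ}` by `2δ√(2M)/(c√|F(0)|)/w + 1` whether or not `F` actually enters `[−δ, δ]`.  At the `m = 3`
umklapp corner the diagonal value `F(0) = D(σ) ≈ 3q·m²` and the anti-diagonal curvature `F(t) − F(0) ≈ q·t²/4` have the SAME sign (elliptic contact,
COUNTING-NOTE-3; Rivasseau's half-filled count, J. Stat. Phys. 106 (2002) Lemma 5, pays one log on FLAT faces — a different geometry), so for `D(σ) > δ`
there is NO admissible `t` at all; summing the sign-blind bound over those `σ` with the fat anchor slack would manufacture a spurious `N log N`.  This file is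
the one-sided fibre lemma that replaces it on the corner window:

* **`gridCount_oneSided_incr`** — if `F(0) > δ ≥ 0` and `F′ ≥ 0` on `[0, τ]` then no grid point `t = w + i·w ≤ τ` has `|F(t)| ≤ δ` (count `= 0`);
  **`gridCount_oneSided_decr`** — the mirror case `F(0) < −δ`, `F′ ≤ 0`;
(The assembly case-splits: same-sign window ⇒ these lemmas; otherwise `gridCount_L5` verbatim.)

Everything is PROVED; no definitions, no named facts.

## Sources

* V. Mastropietro, *Non-Perturbative Renormalization* (World Scientific, 2008), ch. 14 (14.67) p. 223. [Mastropietro2008]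
* G. Benfatto, A. Giuliani, V. Mastropietro, Ann. Henri Poincaré 7 (2006) 809–898, App. A2/A3. [BenfattoGiulianiMastropietro2006]
* V. Rivasseau, J. Stat. Phys. 106 (2002) 693–722 (arXiv:cond-mat/0107118), Lemma 5. [folklore]
-/

noncomputable section

open Real Set

namespace Literature.MathematicalPhysics.QuantumLattice.BandSectorCounting

/-- **One-sided fibre count, increasing case**: if `F` has a derivative `F′ ≥ 0` on `[0, τ]` and `F(0) > δ ≥ 0`, then NO grid point
`t = w + i·w` with `i < K₀`, `K₀·w ≤ τ` satisfies `|F(t)| ≤ δ`. [cite: Mastropietro2008, ch. 14 (14.67)] -/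
theorem gridCount_oneSided_incr {F F' : ℝ → ℝ} (hF : ∀ t, HasDerivAt F (F' t) t) {τ δ : ℝ}
    (hmono : ∀ t, 0 ≤ t → t ≤ τ → 0 ≤ F' t) (h0 : δ < F 0) {w : ℝ} (hw : 0 < w) {K₀ : ℕ} (hK : (K₀ : ℝ) * w ≤ τ) :
    ((Finset.range K₀).filter fun i : ℕ => |F (w + i * w)| ≤ δ).card = 0 := by
  rw [Finset.card_eq_zero, Finset.filter_eq_empty_iff]
  intro i hi hle
  have hi' : (i : ℝ) + 1 ≤ K₀ := by exact_mod_cast Nat.succ_le_of_lt (Finset.mem_range.1 hi)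
  have ht0 : 0 ≤ w + i * w := by positivity
  have htτ : w + i * w ≤ τ := by nlinarith
  -- `F` is monotone on `[0, τ]`
  have hmonoF : MonotoneOn F (Icc 0 τ) :=
    monotoneOn_of_deriv_nonneg (convex_Icc 0 τ) (fun t _ => (hF t).continuousAt.continuousWithinAt)
      (fun t _ => (hF t).differentiableAt.differentiableWithinAt)
      (fun t ht => by
        rw [interior_Icc] at ht
        rw [(hF t).deriv]
        exact hmono t ht.1.le ht.2.le)
  have hFt : F 0 ≤ F (w + i * w) := hmonoF ⟨le_rfl, ht0.trans htτ⟩ ⟨ht0, htτ⟩ ht0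
  have : F (w + i * w) ≤ δ := (le_abs_self _).trans hle
  linarith

/-- **One-sided fibre count, decreasing case**: `F′ ≤ 0` on `[0, τ]` and `F(0) < −δ`, `δ ≥ 0` ⇒ no grid point has `|F(t)| ≤ δ`.
[cite: Mastropietro2008, ch. 14 (14.67)] -/
theorem gridCount_oneSided_decr {F F' : ℝ → ℝ} (hF : ∀ t, HasDerivAt F (F' t) t) {τ δ : ℝ}
    (hmono : ∀ t, 0 ≤ t → t ≤ τ → F' t ≤ 0) (h0 : F 0 < -δ) {w : ℝ} (hw : 0 < w) {K₀ : ℕ} (hK : (K₀ : ℝ) * w ≤ τ) :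
    ((Finset.range K₀).filter fun i : ℕ => |F (w + i * w)| ≤ δ).card = 0 := by
  have h := gridCount_oneSided_incr (F := fun t => -F t) (F' := fun t => -F' t) (fun t => (hF t).neg)
    (τ := τ) (δ := δ) (fun t h1 h2 => by have := hmono t h1 h2; linarith) (by show δ < -F 0; linarith) hw hK
  rw [← h]
  congr 1
  refine Finset.filter_congr fun i _ => ?_
  simp only [abs_neg]

end Literature.MathematicalPhysics.QuantumLattice.BandSectorCounting

end
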